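import Literature.MathematicalPhysics.QuantumFieldTheory.Balaban1983to89.LatticeFieldCalculus
import HarnessLib

/-!
# Route `UnitScaleTilt`, crux K1 «MinimiserStabilityRegPr» (stmt-QuantumFields-19200), route-R E′ architecture (A′) «HCOW-VIA-Σ» (★★OWNER RULING g28-№13), package P-A2 «JOINT-Σ»,
# file F2″ of LOCATE-PA2-JOINT-SIGMA (routeR-w3 g6): **THE ℓ¹ DAMPING OF THE STRAIGHT TUBE AVERAGE** — `Σ_c ‖(QA)(c)‖ ≤ L^{−d}·Σ_b ‖A(b)‖` for the one-step bond block average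
# `Q = bondAvg` of [Balaban1984PropagatorsI] (1.11), hence `Σ_c ‖(Q_kA)(c)‖ ≤ L^{−dk}·Σ_b ‖A(b)‖` and, in the chart's normalisation `L^k·Q_k` ((J2) ✓`Prop7SymAvgTwSym.QTwS_one_apply`),
# `L^k·Σ_c ‖(Q_kA)(c)‖ ≤ (L^{d−1})^{−k}·Σ_b ‖A(b)‖` — at `d = 3` the factor `(L²)⁻¹` per level of ✓`Prop7JointRowOfLevelMasses.jointRow_of_levelMasses`

Cell `ym3-torus`, D-0154 (3c) twin-width seat `ym-routeR-w3` (gen 6).  Pure combinatorics of the centred block parametrisation: every fine bond lies on exactly `L` of the straight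
contours `[x, x(c)]` (`x ∈ B(c₋)`), so the column sums of the tube kernel are `L·L^{−(d+1)} = L^{−d}`; typed as two injectivity steps (`(c, r) ↦` the `t`-th bond of the contour from
`blockSite c₋ r`, for each `t < L`) and the triangle inequality.  THEOREMS ONLY (0 `def`, 0 `sorry`); `--supports stmt-QuantumFields-19200`, count-neutral.  YM₃ on T³ is a ladder rung (R3),
not the Clay problem; nothing here claims the stub, the crux, d = 4 or the gap.

WHAT IS PROVED (ns `…Theorems.Prop7TubeAverageL1Damping`): `sum_comp_le_of_injective` (reindex-and-drop), `runSite_injective`, `runBond_blockSite_injective`, ★`sum_norm_runBond_blockSite_le`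
(one contour position `t`: `Σ_c Σ_r ‖A(t-th bond)‖ ≤ Σ_b ‖A b‖`), ★★★`sum_norm_bondAvg_le` (`Σ_c‖QA(c)‖ ≤ (L^d)⁻¹·Σ_b‖A b‖`), ★★`sum_norm_bondAvgIter_le` (`k` levels), ★★`pow_mul_sum_norm_bondAvgIter_le`
(the chart normalisation: `L^k·Σ‖Q_kA‖ ≤ ((L^{d−1})⁻¹)^k·Σ‖A‖`).

References: T. Bałaban, CMP **95** (1984) 17–40 [Balaban1984PropagatorsI] ((1.11) p.19, (1.16)–(1.18) p.20); CMP **98** (1985) 17–51 [Balaban1985Averaging] ((125)–(127) p.36).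
-/

set_option autoImplicit false

noncomputable section

open scoped BigOperators

namespace Summit.QuantumFields.YangMills.Theorems.Prop7TubeAverageL1Damping

open Literature.MathematicalPhysics.QuantumFieldTheory.Balaban1983to89
open LatticeFieldCalculus
open AveragingRT (blockSite_inj)

variable {P : Params} {j : ℕ} {V : Type*} [NormedAddCommGroup V] [NormedSpace ℝ V]

/-- Reindex-and-drop: a nonnegative function summed along an injective map is at most its full sum. [folklore] -/
theorem sum_comp_le_of_injective {ι κ : Type*} [Fintype ι] [Fintype κ] (φ : ι → κ) (hφ : Function.Injective φ)
    (g : κ → ℝ) (hg : ∀ k, 0 ≤ g k) : ∑ i, g (φ i) ≤ ∑ k, g k := by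
  classical
  have h1 : ∑ i, g (φ i) = ∑ k ∈ Finset.univ.image φ, g k := by
    rw [Finset.sum_image (fun a _ b _ h => hφ h)]
  rw [h1]
  exact Finset.sum_le_sum_of_subset_of_nonneg (Finset.subset_univ _) (fun k _ _ => hg k)

/-- `x ↦ x + t e_μ` is injective on the sites of `T^{(j)}`. [folklore] -/
theorem runSite_injective (μ : Fin P.d) : ∀ t : ℕ, Function.Injective (fun x : Site P j => runSite x μ t)
  | 0 => fun x x' h => by simpa using h
  | t + 1 => fun x x' h => by
      have h1 : (runSite x μ t).shift μ = (runSite x' μ t).shift μ := by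
        have h' : runSite x μ (t + 1) = runSite x' μ (t + 1) := h
        rwa [runSite_succ, runSite_succ] at h'
      have h2 : runSite x μ t = runSite x' μ t := (shiftEquiv (P := P) (j := j) μ).injective h1
      exact runSite_injective μ t h2

/-- For a fixed contour position `t`, `(c, r) ↦` the `t`-th bond of the straight contour issuing from `blockSite c₋ r` in the direction of `c` is injective (standing range).
[cite: Balaban1984PropagatorsI, (1.11) p.19] -/
theorem runBond_blockSite_injective (hj : j + 1 ≤ P.m + P.K) (t : ℕ) :
    Function.Injective (fun q : PBond P (j + 1) × (Fin P.d → Fin P.L) => (runBond (Site.blockSite q.1.src q.2) q.1.dir t : PBond P j)) := by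
  rintro ⟨c, r⟩ ⟨c', r'⟩ h
  have h' : runBond (Site.blockSite c.src r) c.dir t = runBond (Site.blockSite c'.src r') c'.dir t := h
  have hdir := congrArg PBond.dir h'
  have hsrc := congrArg PBond.src h'
  change c.dir = c'.dir at hdir
  change runSite (Site.blockSite c.src r) c.dir t = runSite (Site.blockSite c'.src r') c'.dir t at hsrc
  rw [← hdir] at hsrc
  have hbs : Site.blockSite c.src r = Site.blockSite c'.src r' := runSite_injective c.dir t hsrc
  obtain ⟨hy, hr⟩ := blockSite_inj hj hbs
  subst hr
  have hc : c = c' := by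
    cases c; cases c'
    simp only at hy hdir
    subst hy; subst hdir; rfl
  subst hc
  rfl

omit [NormedSpace ℝ V] in
/-- ★ ONE CONTOUR POSITION: `Σ_c Σ_r ‖A([x_r, x_r(c)]_t)‖ ≤ Σ_b ‖A b‖` for every `t` — each fine bond is the `t`-th bond of at most one contour. [cite: Balaban1984PropagatorsI, (1.11) p.19] -/
theorem sum_norm_runBond_blockSite_le (hj : j + 1 ≤ P.m + P.K) (A : VecField P j V) (t : ℕ) :
    ∑ c : PBond P (j + 1), ∑ r : Fin P.d → Fin P.L, ‖A (runBond (Site.blockSite c.src r) c.dir t)‖ ≤ ∑ b : PBond P j, ‖A b‖ := by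
  have h := sum_comp_le_of_injective _ (runBond_blockSite_injective (P := P) hj t) (fun b => ‖A b‖) (fun _ => norm_nonneg _)
  simpa only [Fintype.sum_prod_type] using h

/-- ★★★ **THE ℓ¹ DAMPING OF THE ONE-STEP TUBE AVERAGE**: `Σ_c ‖(QA)(c)‖ ≤ L^{−d}·Σ_b ‖A(b)‖` (`Q = bondAvg`, weight `L^{−(d+1)}`, `L^d` contours of `L` bonds per coarse bond, every fine bond on
exactly `L` contours). [cite: Balaban1984PropagatorsI, (1.11) p.19] -/
theorem sum_norm_bondAvg_le (hj : j + 1 ≤ P.m + P.K) (A : VecField P j V) :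
    ∑ c : PBond P (j + 1), ‖bondAvg A c‖ ≤ ((P.L : ℝ) ^ P.d)⁻¹ * ∑ b : PBond P j, ‖A b‖ := by
  have hL0 : (0 : ℝ) < (P.L : ℝ) := Nat.cast_pos.mpr P.L_pos
  -- pointwise triangle inequality
  have hpt : ∀ c : PBond P (j + 1), ‖bondAvg A c‖ ≤ ((P.L : ℝ) ^ (P.d + 1))⁻¹ *
      ∑ r : Fin P.d → Fin P.L, ∑ t ∈ Finset.range P.L, ‖A (runBond (Site.blockSite c.src r) c.dir t)‖ := by
    intro c
    show ‖(((P.L : ℝ) ^ (P.d + 1))⁻¹) • ∑ r : Fin P.d → Fin P.L, segSum A (Site.blockSite c.src r) c.dir P.L‖ ≤ _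
    rw [norm_smul, Real.norm_of_nonneg (by positivity)]
    refine mul_le_mul_of_nonneg_left ((norm_sum_le _ _).trans (Finset.sum_le_sum fun r _ => ?_)) (by positivity)
    show ‖∑ t ∈ Finset.range P.L, A (runBond (Site.blockSite c.src r) c.dir t)‖ ≤ _
    exact norm_sum_le _ _
  have h1 : ∑ c : PBond P (j + 1), ‖bondAvg A c‖ ≤ ((P.L : ℝ) ^ (P.d + 1))⁻¹ *
      ∑ c : PBond P (j + 1), ∑ r : Fin P.d → Fin P.L, ∑ t ∈ Finset.range P.L, ‖A (runBond (Site.blockSite c.src r) c.dir t)‖ := by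
    rw [Finset.mul_sum]
    exact Finset.sum_le_sum fun c _ => hpt c
  have h2 : ∑ c : PBond P (j + 1), ∑ r : Fin P.d → Fin P.L, ∑ t ∈ Finset.range P.L, ‖A (runBond (Site.blockSite c.src r) c.dir t)‖
      ≤ (P.L : ℝ) * ∑ b : PBond P j, ‖A b‖ := by
    calc ∑ c : PBond P (j + 1), ∑ r : Fin P.d → Fin P.L, ∑ t ∈ Finset.range P.L, ‖A (runBond (Site.blockSite c.src r) c.dir t)‖
        = ∑ c : PBond P (j + 1), ∑ t ∈ Finset.range P.L, ∑ r : Fin P.d → Fin P.L, ‖A (runBond (Site.blockSite c.src r) c.dir t)‖ :=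
          Finset.sum_congr rfl fun c _ => Finset.sum_comm
      _ = ∑ t ∈ Finset.range P.L, ∑ c : PBond P (j + 1), ∑ r : Fin P.d → Fin P.L, ‖A (runBond (Site.blockSite c.src r) c.dir t)‖ := Finset.sum_comm
      _ ≤ ∑ t ∈ Finset.range P.L, ∑ b : PBond P j, ‖A b‖ := Finset.sum_le_sum fun t _ => sum_norm_runBond_blockSite_le hj A t
      _ = (P.L : ℝ) * ∑ b : PBond P j, ‖A b‖ := by rw [Finset.sum_const, Finset.card_range, nsmul_eq_mul]
  calc ∑ c : PBond P (j + 1), ‖bondAvg A c‖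
      ≤ ((P.L : ℝ) ^ (P.d + 1))⁻¹ * ∑ c : PBond P (j + 1), ∑ r : Fin P.d → Fin P.L, ∑ t ∈ Finset.range P.L, ‖A (runBond (Site.blockSite c.src r) c.dir t)‖ := h1
    _ ≤ ((P.L : ℝ) ^ (P.d + 1))⁻¹ * ((P.L : ℝ) * ∑ b : PBond P j, ‖A b‖) := mul_le_mul_of_nonneg_left h2 (by positivity)
    _ = ((P.L : ℝ) ^ P.d)⁻¹ * ∑ b : PBond P j, ‖A b‖ := by
        rw [pow_succ, mul_inv, mul_assoc, inv_mul_cancel_left₀ hL0.ne']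

/-- ★★ `k` LEVELS: `Σ_c ‖(Q_kA)(c)‖ ≤ (L^{−d})^k·Σ_b ‖A(b)‖` (`Q_k = bondAvgIter k`, [Balaban1984PropagatorsI] (1.16)–(1.18)). [cite: Balaban1984PropagatorsI, (1.18) p.20] -/
theorem sum_norm_bondAvgIter_le : ∀ (k : ℕ), k ≤ P.m + P.K → ∀ A : VecField P 0 V,
    ∑ c : PBond P k, ‖bondAvgIter k A c‖ ≤ (((P.L : ℝ) ^ P.d)⁻¹) ^ k * ∑ b : PBond P 0, ‖A b‖
  | 0, _, A => by
      show ∑ c : PBond P 0, ‖A c‖ ≤ _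
      rw [pow_zero, one_mul]
  | k + 1, hk, A => by
      show ∑ c : PBond P (k + 1), ‖bondAvg (bondAvgIter k A) c‖ ≤ _
      calc ∑ c : PBond P (k + 1), ‖bondAvg (bondAvgIter k A) c‖
          ≤ ((P.L : ℝ) ^ P.d)⁻¹ * ∑ b : PBond P k, ‖bondAvgIter k A b‖ := sum_norm_bondAvg_le (by omega) _
        _ ≤ ((P.L : ℝ) ^ P.d)⁻¹ * ((((P.L : ℝ) ^ P.d)⁻¹) ^ k * ∑ b : PBond P 0, ‖A b‖) :=
            mul_le_mul_of_nonneg_left (sum_norm_bondAvgIter_le k (by omega) A) (by positivity)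
        _ = (((P.L : ℝ) ^ P.d)⁻¹) ^ (k + 1) * ∑ b : PBond P 0, ‖A b‖ := by rw [pow_succ]; ring

/-- ★★ THE CHART NORMALISATION: `L^k·Σ_c ‖(Q_kA)(c)‖ ≤ ((L^{d−1})⁻¹)^k·Σ_b ‖A(b)‖` — at `d = 3` the damping `(L²)⁻¹` per level of ✓`Prop7JointRowOfLevelMasses.jointRow_of_levelMasses`
((J2): `QTwS 1 = L^{K−n}·bondAvgIter (K−n)`). [cite: Balaban1984PropagatorsI, (1.18) p.20; Balaban1985Averaging, (125)–(127) p.36] -/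
theorem pow_mul_sum_norm_bondAvgIter_le (hd : 1 ≤ P.d) (k : ℕ) (hk : k ≤ P.m + P.K) (A : VecField P 0 V) :
    (P.L : ℝ) ^ k * ∑ c : PBond P k, ‖bondAvgIter k A c‖ ≤ (((P.L : ℝ) ^ (P.d - 1))⁻¹) ^ k * ∑ b : PBond P 0, ‖A b‖ := by
  have hL0 : (0 : ℝ) < (P.L : ℝ) := Nat.cast_pos.mpr P.L_pos
  have h := mul_le_mul_of_nonneg_left (sum_norm_bondAvgIter_le (P := P) k hk A) (pow_nonneg hL0.le k)
  refine h.trans (le_of_eq ?_)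
  rw [← mul_assoc, ← mul_pow]
  congr 2
  obtain ⟨e, he⟩ : ∃ e, P.d = e + 1 := ⟨P.d - 1, by omega⟩
  rw [he, Nat.add_sub_cancel, pow_succ, mul_inv, ← mul_assoc, mul_comm ((P.L : ℝ)) _, mul_assoc, mul_inv_cancel₀ hL0.ne', mul_one]

end Summit.QuantumFields.YangMills.Theorems.Prop7TubeAverageL1Damping

end
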